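import Mathlib
import HarnessLib
import Literature.Analysis.Calculus.IteratedDerivLeibnizBound

/-!
# Route `KLProgramme` — crux C4a, S3 brick (B4) «(U1)-HYBRID» / «SWAP-BY-SYMMETRY» kernel side AT EVERY ORDER: the partner's level bump absorbed into a
# kernel family — the order-`k` rows transfer from `Kr` to `(e,u) ↦ χ(u)·Kr(e,u)/C` by Leibniz (`C ≥ 2ᵏ·(1 + B_χ·max(1,R)ᵏ)`)

Cell `gate-hubbard-kl`, seat hubbard-kl-k3c3-p1 (g20; row «δμ-flow with klAngularMean constant piece»).  The order-`≤ 2` transfer is k3c3-p3 g38's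
`…C4aKernelBumpRows` (`bumpKernel_hKd/_hK0/_hK0s/_hK1/_hKs1/_hK2/_hKc`, bump `χ ∈ C²`, `χ′ = χ″ = 0` off `|u| < R`, `lo ≤ hi ≤ R`); this file is its analogue
for the ORDER-`k` ROW BUNDLE of this seat's «(U1)-K-JETS-ALL-ORDERS» / «PIECES ALL ORDERS» chain (`ppTrueKernel_orderRows`, `ppFarKernelS_orderRows`,
`ppMidKernelS_orderRows`: `C^k` in `u` ∧ `∀ j ≤ k` joint continuity of `∂ᵤʲKr` ∧ `|∂ᵤʲKr(e,·)(u)| ≤ (max |e| |u|)⁻¹^(j+1)` on the box `|e| ≤ hi`, `e ≠ 0` ∧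
`≤ (max lo |u|)⁻¹^(j+1)` on the strip `|e| ≤ lo`), kernel-agnostic:
* §1 `bump_factor_row` — a `C^k` bump with `|χ| ≤ 1`, `|χ⁽ʲ⁾| ≤ B_χ` and `χ⁽ʲ⁾ = 0` on `|u| ≥ R` (`1 ≤ j ≤ k`) has factor rows `|χ⁽ʲ⁾(u)| ≤ (1 + B_χ·max(1,R)ᵏ)·ρ^{−j}`
  for every currency radius `0 < ρ` with `|u| < R ⟹ ρ ≤ R` (both `ρ = max |e| |u|`, `|e| ≤ hi ≤ R`, and `ρ = max lo |u|`, `lo ≤ R`, qualify);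
* §2 `abs_iteratedDeriv_kernel_mul_bump_le` — Leibniz: kernel rows `ρ^{−(i+1)}` × factor rows `B·ρ^{−j}` ⟹ `|∂ᵤʲ(Kr·χ)| ≤ 2ʲ·B·ρ^{−(j+1)}`
  (`Literature…IteratedDerivLeibnizBound.norm_iteratedDeriv_mul_le_of_geometric`);
* §3 **`bumpKernel_orderRows`** — the four-part order-`k` bundle for `fun e u => χ u * Kr e u / C`, any `C ≥ 2ᵏ·(1 + B_χ·max(1,R)ᵏ)`.
Pure one-variable calculus; nothing about the model; nothing asserts (C), K3, the window or superconductivity.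
References: BGM 2006 §2.4 (2.36) [cite: BenfattoGiulianiMastropietro2006]; FST II CPAM 51 (1998) §3 [cite: FeldmanSalmhoferTrubowitz1998].
-/

noncomputable section

namespace Summit.HubbardSuperconductivity.HubbardSuperconductivity.Theorems.C4a

set_option linter.dupNamespace false -- summit = problem name (single-conjunct summit), D-0017

open Real Set Filter Finset
open scoped Topology Nat
open Literature.Analysis.Calculus

/-! ## §1 The bump's factor rows in a currency radius -/

/-- **Factor rows of the bump**: `|χ⁽ʲ⁾(u)| ≤ (1 + B_χ·max(1,R)ᵏ)·(1/ρ)ʲ` for `j ≤ k`, whenever `0 < ρ` and `|u| < R ⟹ ρ ≤ R`. [folklore] -/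
theorem bump_factor_row {k : ℕ} {χ : ℝ → ℝ} {Bχ R : ℝ} (hBχ : 0 ≤ Bχ) (hχ0 : ∀ u, |χ u| ≤ 1)
    (hχj : ∀ j, 1 ≤ j → j ≤ k → ∀ u, |iteratedDeriv j χ u| ≤ Bχ) (hχz : ∀ j, 1 ≤ j → j ≤ k → ∀ u, R ≤ |u| → iteratedDeriv j χ u = 0)
    {ρ u : ℝ} (hρ : 0 < ρ) (hρR : |u| < R → ρ ≤ R) :
    ∀ j ≤ k, |iteratedDeriv j χ u| ≤ (1 + Bχ * max 1 R ^ k) * (1 / ρ) ^ j := by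
  intro j hj
  have hM1 : 1 ≤ max 1 R := le_max_left _ _
  have hB0 : 0 ≤ Bχ * max 1 R ^ k := by positivity
  rcases Nat.eq_zero_or_pos j with rfl | hj1
  · simp only [iteratedDeriv_zero, pow_zero, mul_one]
    exact (hχ0 u).trans (by linarith)
  · by_cases huR : R ≤ |u|
    · rw [hχz j hj1 hj u huR, abs_zero]; positivity
    · have hlt : |u| < R := lt_of_not_ge huR
      have hρR' : ρ ≤ R := hρR hlt
      have hR0 : 0 < R := hρ.trans_le hρR'
      -- `1 ≤ (R/ρ)^j ≤ max(1,R)^k·(1/ρ)^j`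
      have h1 : (1 : ℝ) ≤ (R * (1 / ρ)) ^ j := one_le_pow₀ (by rw [mul_one_div, le_div_iff₀ hρ, one_mul]; exact hρR')
      have h2 : (R * (1 / ρ)) ^ j ≤ max 1 R ^ k * (1 / ρ) ^ j := by
        rw [mul_pow]
        refine mul_le_mul_of_nonneg_right ((pow_le_pow_left₀ hR0.le (le_max_right 1 R) j).trans (pow_le_pow_right₀ hM1 hj)) (by positivity)
      calc |iteratedDeriv j χ u| ≤ Bχ := hχj j hj1 hj u
        _ ≤ Bχ * (max 1 R ^ k * (1 / ρ) ^ j) := by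
            have := h1.trans h2
            nlinarith
        _ ≤ (1 + Bχ * max 1 R ^ k) * (1 / ρ) ^ j := by
            have : 0 ≤ (1 / ρ) ^ j := by positivity
            nlinarith

/-! ## §2 Leibniz: kernel rows × factor rows -/

/-- **Kernel × bump**: `|∂ⁱK(u)| ≤ ρ^{−(i+1)}` (`i ≤ j`) and `|∂ⁱχ(u)| ≤ B·ρ^{−i}` (`i ≤ j`) ⟹ `|∂ʲ(χ·K)(u)| ≤ 2ʲ·B·ρ^{−(j+1)}`. [folklore] -/
theorem abs_iteratedDeriv_kernel_mul_bump_le {K χ : ℝ → ℝ} {j : ℕ} (hK : ContDiff ℝ j K) (hχ : ContDiff ℝ j χ) (u : ℝ) {ρ B : ℝ} (hρ : 0 < ρ)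
    (hKr : ∀ i ≤ j, |iteratedDeriv i K u| ≤ (1 / ρ) ^ (i + 1)) (hχr : ∀ i ≤ j, |iteratedDeriv i χ u| ≤ B * (1 / ρ) ^ i) :
    |iteratedDeriv j (fun v : ℝ => χ v * K v) u| ≤ 2 ^ j * B * (1 / ρ) ^ (j + 1) := by
  have hfun : (fun v : ℝ => χ v * K v) = fun v : ℝ => K v * χ v := by funext v; ring
  rw [hfun]
  have h := norm_iteratedDeriv_mul_le_of_geometric hK hχ u (A := 1 / ρ) (B := B) (ρ := 1 / ρ) (by positivity)
    (fun i hi => by rw [Real.norm_eq_abs, ← pow_succ']; exact hKr i hi) (fun i hi => by rw [Real.norm_eq_abs]; exact hχr i hi)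
  rw [Real.norm_eq_abs] at h
  refine h.trans (le_of_eq ?_)
  ring

/-! ## §3 The order-`k` bundle of the bumped family -/

/-- **THE ORDER-`k` ROWS TRANSFER TO THE BUMPED FAMILY `χ(u)·Kr(e,u)/C`**: from `Kr`'s order-`k` bundle (`C^k`; `∀ j ≤ k` joint continuity of `∂ᵤʲKr`;
box rows `(max |e| |u|)⁻¹^(j+1)`, `|e| ≤ hi`, `e ≠ 0`; strip rows `(max lo |u|)⁻¹^(j+1)`, `|e| ≤ lo`) and a `C^k` bump (`|χ| ≤ 1`, `|χ⁽ʲ⁾| ≤ B_χ`,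
`χ⁽ʲ⁾ = 0` on `|u| ≥ R` for `1 ≤ j ≤ k`; `0 < lo ≤ hi ≤ R`), the same bundle for the bumped family with any `C ≥ 2ᵏ·(1 + B_χ·max(1,R)ᵏ)`.
[cite: BenfattoGiulianiMastropietro2006, §2.4 (2.36)] -/
theorem bumpKernel_orderRows {k : ℕ} {χ : ℝ → ℝ} (hχ : ContDiff ℝ k χ) {Bχ R : ℝ} (hBχ : 0 ≤ Bχ) (hχ0 : ∀ u, |χ u| ≤ 1)
    (hχj : ∀ j, 1 ≤ j → j ≤ k → ∀ u, |iteratedDeriv j χ u| ≤ Bχ) (hχz : ∀ j, 1 ≤ j → j ≤ k → ∀ u, R ≤ |u| → iteratedDeriv j χ u = 0)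
    {Kr : ℝ → ℝ → ℝ} {lo hi : ℝ} (hlo : 0 < lo) (hlohi : lo ≤ hi) (hhiR : hi ≤ R)
    (hKd : ∀ e, ContDiff ℝ k (Kr e)) (hKc : ∀ j ≤ k, Continuous fun p : ℝ × ℝ => iteratedDeriv j (Kr p.1) p.2)
    (hK : ∀ j ≤ k, ∀ e ∈ Icc (-hi) hi, e ≠ 0 → ∀ u, |iteratedDeriv j (Kr e) u| ≤ (max |e| |u|)⁻¹ ^ (j + 1))
    (hKs : ∀ j ≤ k, ∀ e ∈ Icc (-lo) lo, ∀ u, |iteratedDeriv j (Kr e) u| ≤ (max lo |u|)⁻¹ ^ (j + 1))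
    {C : ℝ} (hC : 0 < C) (hCk : 2 ^ k * (1 + Bχ * max 1 R ^ k) ≤ C) :
    (∀ e, ContDiff ℝ k (fun v : ℝ => χ v * Kr e v / C)) ∧
      (∀ j ≤ k, Continuous fun p : ℝ × ℝ => iteratedDeriv j (fun v : ℝ => χ v * Kr p.1 v / C) p.2) ∧
      (∀ j ≤ k, ∀ e ∈ Icc (-hi) hi, e ≠ 0 → ∀ u, |iteratedDeriv j (fun v : ℝ => χ v * Kr e v / C) u| ≤ (max |e| |u|)⁻¹ ^ (j + 1)) ∧
      (∀ j ≤ k, ∀ e ∈ Icc (-lo) lo, ∀ u, |iteratedDeriv j (fun v : ℝ => χ v * Kr e v / C) u| ≤ (max lo |u|)⁻¹ ^ (j + 1)) := by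
  have hM1 : 1 ≤ max 1 R := le_max_left _ _
  have hB0 : 0 ≤ 1 + Bχ * max 1 R ^ k := by positivity
  -- the row in a radius, divided by `C`
  have hrow : ∀ j ≤ k, ∀ (e u ρ : ℝ), 0 < ρ → (|u| < R → ρ ≤ R) → (∀ i ≤ j, |iteratedDeriv i (Kr e) u| ≤ (1 / ρ) ^ (i + 1)) →
      |iteratedDeriv j (fun v : ℝ => χ v * Kr e v / C) u| ≤ (1 / ρ) ^ (j + 1) := by
    intro j hj e u ρ hρ hρR hKr
    have hN : ((j : ℕ∞) : WithTop ℕ∞) ≤ ((k : ℕ∞) : WithTop ℕ∞) := by exact_mod_cast hj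
    have h := abs_iteratedDeriv_kernel_mul_bump_le ((hKd e).of_le hN) (hχ.of_le hN) u hρ hKr
      (fun i hi => bump_factor_row hBχ hχ0 hχj hχz hρ hρR i (hi.trans hj))
    rw [iteratedDeriv_div_const, abs_div, abs_of_pos hC, div_le_iff₀ hC]
    refine h.trans ?_
    rw [mul_comm ((1 / ρ) ^ (j + 1)) C]
    refine mul_le_mul_of_nonneg_right ((mul_le_mul_of_nonneg_right (pow_le_pow_right₀ (by norm_num) hj) hB0).trans hCk) (by positivity)
  refine ⟨fun e => (hχ.mul (hKd e)).div_const C, fun j hj => ?_, fun j hj e he hne u => ?_, fun j hj e he u => ?_⟩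
  · -- joint continuity by the Leibniz formula
    have hN : ((j : ℕ∞) : WithTop ℕ∞) ≤ ((k : ℕ∞) : WithTop ℕ∞) := by exact_mod_cast hj
    have hfun : (fun p : ℝ × ℝ => iteratedDeriv j (fun v : ℝ => χ v * Kr p.1 v / C) p.2) = fun p : ℝ × ℝ =>
        (∑ i ∈ Finset.range (j + 1), (j.choose i : ℝ) * iteratedDeriv i χ p.2 * iteratedDeriv (j - i) (Kr p.1) p.2) / C := by
      funext p
      rw [iteratedDeriv_div_const]
      congr 1
      exact iteratedDeriv_fun_mul ((hχ.of_le hN).contDiffAt) (((hKd p.1).of_le hN).contDiffAt)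
    rw [hfun]
    refine Continuous.div_const (continuous_finsetSum _ fun i hi' => ?_) C
    have him : i ≤ j := Nat.lt_succ_iff.1 (Finset.mem_range.1 hi')
    exact (continuous_const.mul ((hχ.continuous_iteratedDeriv i (by exact_mod_cast him.trans hj)).comp continuous_snd)).mul
      (hKc (j - i) ((Nat.sub_le j i).trans hj))
  · have hρ : 0 < max |e| |u| := lt_max_of_lt_left (abs_pos.2 hne)
    have hehi : |e| ≤ hi := abs_le.2 ⟨he.1, he.2⟩
    have h := hrow j hj e u (max |e| |u|) hρ (fun huR => max_le (hehi.trans hhiR) huR.le)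
      (fun i hi => by rw [one_div]; exact hK i (hi.trans hj) e he hne u)
    rwa [one_div] at h
  · have hρ : 0 < max lo |u| := lt_max_of_lt_left hlo
    have h := hrow j hj e u (max lo |u|) hρ (fun huR => max_le (hlohi.trans hhiR) huR.le)
      (fun i hi => by rw [one_div]; exact hKs i (hi.trans hj) e he u)
    rwa [one_div] at h

end Summit.HubbardSuperconductivity.HubbardSuperconductivity.Theorems.C4a

end
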